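import Summits.FinalStateConjecture.FinalStateConjecture.Theorems.ClusterCompletenessLinearToNonlinearCaptureTwoPinsDefs
import HarnessLib

/-!
# Crux `LinearToNonlinearCapture` (stmt-FinalStateConjecture-14526), line `two-pins-and-completeness` —
# stub `stub_pinnedExits` (S2), glue: `PinnedExitsFlatCut` from its two irreducible exits

Helper file (`--supports stmt-FinalStateConjecture-14526`) for the registered stub
`stub_pinnedExits : ∃ k, ∀ …, ChartBlock … → RecurAt k … → PinnedExitsFlatCut …` of the skeleton
`LinearToNonlinearCapture` (route `ClusterCompleteness`), reshape 1.

The corrected waypoint `PinnedExitsFlatCut` (`…TwoPinsDefs`, reshape 1) is the conjunction of a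
HORIZON EXIT (H) and a NULL-INFINITY EXIT (B). The stub worker's audit
(`stub_pinnedExits.findings.md` on the crux item) isolates the two research-grade inputs it needs —
F_H: an advanced-time foliation `H : EventHorizonArea` of the event horizon of the charted late set,
synchronised with chart time, with MONOTONE (area theorem, Chruściel–Delay–Galloway–Howard 2001,
Thm. 1.1 (b): `VacuumCauchyDevelopment.monotone_horizonArea` from the named fact
`ChruscielEtAl2001_areaTheorem` once `∂I⁻(C)` is known to be an achronal topological hypersurface
ruled by future-COMPLETE generators = future asymptotic predictability of the charted exterior) and
BOUNDED section areas; F_B: a subluminally receding cut radius `S` for the flat chart's ball slabs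
`K₀ τ = Ψ₀ '' {x⁰ = τ, |x̲| ≤ S τ}` whose cones carry Bondi energies (`HasCutBondiMass`), with the
rest masses `cutBondiMass (K₀ τ)` bounded below (positivity of the Bondi energy) and each late
cut eventually dominating all later ones (Bondi mass loss along `𝓘⁺`, the cuts moving to later
retarded times since `τ − S τ → ∞`). This file proves the ORDER-THEORETIC glue turning exactly these
inputs into `PinnedExitsFlatCut`: the final area is `A∞ := ⨆ᵥ area(S_v)` (monotone convergence in
`ℝ≥0∞`, `tendsto_atTop_iSup`), the final mass is `μ := ⨅_{τ > τ₀} cutBondiMass (K₀ τ)` (eventual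
domination + lower bound ⇒ convergence to the infimum, an `ε`-argument in `ℝ`). No geometry is
done here; the geometric content stays in the hypotheses, typed over the tree's vocabulary
(`EventHorizonArea`, `horizonArea`, `eventHorizon`, `HasCutBondiMass`, `cutBondiMass`).
Mathlib only: `tendsto_atTop_iSup` (monotone convergence in `ℝ≥0∞`), `csInf_le`, `csInf_lt_iff`,
`tendsto_order` (order characterisation of `Tendsto … (𝓝 μ)`), `eventually_gt_atTop`.
-/

set_option linter.dupNamespace false

noncomputable section

open scoped BigOperators Topology Manifold ENNReal ContDiff InnerProductSpace RealInnerProductSpace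
open Filter Set Function TopologicalSpace MeasureTheory

namespace Summit.FinalStateConjecture.FinalStateConjecture.Theorems.ClusterCompleteness.TwoPins

open Literature.Geometry.Lorentzian
open Summit.FinalStateConjecture.FinalStateConjecture.Theorems.ClusterCompleteness

/-- **Convergence to the infimum from eventual domination** (real line): if `f` is bounded below
by `b` on `(τ₀, ∞)` and every value `f τ`, `τ > τ₀`, eventually dominates `f` (`∀ᶠ τ', f τ' ≤ f τ`
— e.g. `f` antitone on `(τ₀, ∞)`), then `μ := inf_{τ > τ₀} f τ` is a lower bound of `f` on
`(τ₀, ∞)` and `f → μ` at `+∞`. [folklore] -/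
theorem exists_le_and_tendsto_of_eventually_le {f : ℝ → ℝ} {τ₀ b : ℝ}
    (hdom : ∀ τ : ℝ, τ₀ < τ → ∀ᶠ τ' in atTop, f τ' ≤ f τ) (hb : ∀ τ : ℝ, τ₀ < τ → b ≤ f τ) :
    ∃ μ : ℝ, (∀ τ : ℝ, τ₀ < τ → μ ≤ f τ) ∧ Tendsto f atTop (𝓝 μ) := by
  have hne : (f '' Ioi τ₀).Nonempty := ⟨f (τ₀ + 1), τ₀ + 1, lt_add_one τ₀, rfl⟩
  have hbdd : BddBelow (f '' Ioi τ₀) := ⟨b, by rintro _ ⟨τ, hτ, rfl⟩; exact hb τ hτ⟩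
  refine ⟨sInf (f '' Ioi τ₀), fun τ hτ ↦ csInf_le hbdd ⟨τ, hτ, rfl⟩, ?_⟩
  rw [tendsto_order]
  refine ⟨fun c hc ↦ ?_, fun c hc ↦ ?_⟩
  · filter_upwards [eventually_gt_atTop τ₀] with τ hτ
    exact hc.trans_le (csInf_le hbdd ⟨τ, hτ, rfl⟩)
  · obtain ⟨_, ⟨τ, hτ, rfl⟩, hlt⟩ := (csInf_lt_iff hbdd hne).1 hc
    exact (hdom τ hτ).mono fun τ' h ↦ h.trans_lt hlt

/-- **`PinnedExitsFlatCut` from its two exits (glue for S2).** For a vacuum Cauchy development `𝒟`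
with hole charts `Ψᵢ`, flat chart `Ψ₀` on `U₀`, exhaustion radii `Rᵢ` and start time `τ₀`, write
`C := ⋃ᵢ Ψᵢ '' lateRegionᵢ τ₀ ∪ Ψ₀ '' lateRegion₀ τ₀` (the charted late set) and
`K₀ τ := Ψ₀ '' {x ∈ U₀ | x⁰ = τ, |x̲| ≤ S τ}` (the flat ball slab of radius `S τ`). Suppose
(h1) `H` is an advanced-time foliation of the event horizon `∂I⁻(C) ∩ J⁺(ιX)` (`EventHorizonArea`)
SYNCHRONISED with chart time (every fixed leaf's horizon section is eventually disjoint from the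
chronological future of the certified near-zone slabs at time `v`); (h2) its section areas are
MONOTONE (the output of the area theorem, Chruściel–Delay–Galloway–Howard 2001, Thm. 1.1 (b) —
`VacuumCauchyDevelopment.monotone_horizonArea` under future-complete generators); (h3) and BOUNDED
by some `A₀ < ∞`; (h4) `S → ∞`, `τ − S τ → ∞`, and every late flat cut has a Bondi energy
(`HasCutBondiMass (K₀ τ) m`); (h5) every late cut's rest mass eventually dominates the later ones,
`∀ τ > τ₀, ∀ᶠ τ', cutBondiMass (K₀ τ') ≤ cutBondiMass (K₀ τ)` (Bondi mass loss; in particular if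
`τ ↦ cutBondiMass (K₀ τ)` is antitone on `(τ₀, ∞)`); (h6) the rest masses of the late cuts are
bounded below by some `μ₀` (positivity of the Bondi energy). THEN `PinnedExitsFlatCut` holds, with
final area `A∞ = ⨆ᵥ area(S_v)` and final mass `μ = inf_{τ > τ₀} cutBondiMass (K₀ τ)`. Pure order
theory (`tendsto_atTop_iSup`; `exists_le_and_tendsto_of_eventually_le`). [folklore] -/
theorem pinnedExitsFlatCut_of_exits :
    ∀ {X : Type} [TopologicalSpace X] [ChartedSpace E3 X] [IsManifold (𝓡 3) ∞ X]
      [ConnectedSpace X] {D : InitialDataSet (𝓡 3) X} (𝒟 : VacuumCauchyDevelopment D) {N : ℕ}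
      (M a : Fin N → ℝ) (mo : Fin N → lorentzGroup × E4) (τ₀ : ℝ)
      (Ψ : ∀ i, boostedKerrExterior (mo i).1 (mo i).2 (M i) (a i) → 𝒟.carrier)
      (R : Fin N → ℝ → ℝ) (U₀ : Opens E4) (Ψ₀ : U₀ → 𝒟.carrier)
      (H : EventHorizonArea 𝒟.toCauchyDevelopment
        ((⋃ i, Ψ i '' (boostedKerrBackground (mo i).1 (mo i).2 (M i) (a i)).lateRegion τ₀) ∪
          Ψ₀ '' (Minkowski.backgroundOn U₀).lateRegion τ₀))
      (A₀ : ℝ≥0∞) (S : ℝ → ℝ) (μ₀ : ℝ),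
      (∀ w : ℝ, ∀ᶠ v in atTop, ∀ i, Disjoint
        (Set.range (H.leaf w) ∩ 𝒟.toCauchyDevelopment.eventHorizon
          ((⋃ j, Ψ j '' (boostedKerrBackground (mo j).1 (mo j).2 (M j) (a j)).lateRegion τ₀) ∪
            Ψ₀ '' (Minkowski.backgroundOn U₀).lateRegion τ₀))
        (𝒟.metric.chronologicalFuture 𝒟.timeOrientation (Ψ i ''
          (boostedKerrBackground (mo i).1 (mo i).2 (M i) (a i)).truncTimeSlab (R i v) v))) →
      Monotone H.horizonArea → A₀ ≠ ⊤ → (∀ v, H.horizonArea v ≤ A₀) →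
      Tendsto S atTop atTop → Tendsto (fun τ ↦ τ - S τ) atTop atTop →
      (∀ τ : ℝ, τ₀ < τ → ∃ m : ℝ, 𝒟.toCauchyDevelopment.HasCutBondiMass
        (Ψ₀ '' (Minkowski.backgroundOn U₀).truncTimeSlab (S τ) τ) m) →
      (∀ τ : ℝ, τ₀ < τ → ∀ᶠ τ' in atTop,
        𝒟.toCauchyDevelopment.cutBondiMass
            (Ψ₀ '' (Minkowski.backgroundOn U₀).truncTimeSlab (S τ') τ') ≤
          𝒟.toCauchyDevelopment.cutBondiMass
            (Ψ₀ '' (Minkowski.backgroundOn U₀).truncTimeSlab (S τ) τ)) →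
      (∀ τ : ℝ, τ₀ < τ → μ₀ ≤ 𝒟.toCauchyDevelopment.cutBondiMass
        (Ψ₀ '' (Minkowski.backgroundOn U₀).truncTimeSlab (S τ) τ)) →
      PinnedExitsFlatCut 𝒟 M a mo τ₀ Ψ R U₀ Ψ₀ := by
  intro X _ _ _ _ D 𝒟 N M a mo τ₀ Ψ R U₀ Ψ₀ H A₀ S μ₀ hsync hmono hA₀ hbd hS hτS hcut hdom hμ₀
  obtain ⟨μ, hμ, hlim⟩ := exists_le_and_tendsto_of_eventually_le hdom hμ₀
  unfold PinnedExitsFlatCut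
  exact ⟨⟨H, ⨆ v, H.horizonArea v, ne_top_of_le_ne_top hA₀ (iSup_le hbd), hsync,
    fun v ↦ le_iSup H.horizonArea v, tendsto_atTop_iSup hmono⟩, S, hS, hτS, hcut, μ, hμ, hlim⟩

/-- **`PinnedExitsFlatCut` from its two exits, antitone form** (the mass-loss hypothesis as
ANTITONICITY of `τ ↦ cutBondiMass (K₀ τ)` on `(τ₀, ∞)`, i.e. for causally ordered late cuts):
corollary of `pinnedExitsFlatCut_of_exits`. [folklore] -/
theorem pinnedExitsFlatCut_of_exits_of_antitoneOn
    {X : Type} [TopologicalSpace X] [ChartedSpace E3 X] [IsManifold (𝓡 3) ∞ X]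
    [ConnectedSpace X] {D : InitialDataSet (𝓡 3) X} (𝒟 : VacuumCauchyDevelopment D) {N : ℕ}
    (M a : Fin N → ℝ) (mo : Fin N → lorentzGroup × E4) (τ₀ : ℝ)
    (Ψ : ∀ i, boostedKerrExterior (mo i).1 (mo i).2 (M i) (a i) → 𝒟.carrier)
    (R : Fin N → ℝ → ℝ) (U₀ : Opens E4) (Ψ₀ : U₀ → 𝒟.carrier)
    (H : EventHorizonArea 𝒟.toCauchyDevelopment
      ((⋃ i, Ψ i '' (boostedKerrBackground (mo i).1 (mo i).2 (M i) (a i)).lateRegion τ₀) ∪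
        Ψ₀ '' (Minkowski.backgroundOn U₀).lateRegion τ₀))
    (hsync : ∀ w : ℝ, ∀ᶠ v in atTop, ∀ i, Disjoint
      (Set.range (H.leaf w) ∩ 𝒟.toCauchyDevelopment.eventHorizon
        ((⋃ j, Ψ j '' (boostedKerrBackground (mo j).1 (mo j).2 (M j) (a j)).lateRegion τ₀) ∪
          Ψ₀ '' (Minkowski.backgroundOn U₀).lateRegion τ₀))
      (𝒟.metric.chronologicalFuture 𝒟.timeOrientation (Ψ i ''
        (boostedKerrBackground (mo i).1 (mo i).2 (M i) (a i)).truncTimeSlab (R i v) v)))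
    (hmono : Monotone H.horizonArea) {A₀ : ℝ≥0∞} (hA₀ : A₀ ≠ ⊤)
    (hbd : ∀ v, H.horizonArea v ≤ A₀) {S : ℝ → ℝ} (hS : Tendsto S atTop atTop)
    (hτS : Tendsto (fun τ ↦ τ - S τ) atTop atTop)
    (hcut : ∀ τ : ℝ, τ₀ < τ → ∃ m : ℝ, 𝒟.toCauchyDevelopment.HasCutBondiMass
      (Ψ₀ '' (Minkowski.backgroundOn U₀).truncTimeSlab (S τ) τ) m)
    (hanti : AntitoneOn (fun τ ↦ 𝒟.toCauchyDevelopment.cutBondiMass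
      (Ψ₀ '' (Minkowski.backgroundOn U₀).truncTimeSlab (S τ) τ)) (Set.Ioi τ₀))
    {μ₀ : ℝ} (hμ₀ : ∀ τ : ℝ, τ₀ < τ → μ₀ ≤ 𝒟.toCauchyDevelopment.cutBondiMass
      (Ψ₀ '' (Minkowski.backgroundOn U₀).truncTimeSlab (S τ) τ)) :
    PinnedExitsFlatCut 𝒟 M a mo τ₀ Ψ R U₀ Ψ₀ :=
  pinnedExitsFlatCut_of_exits 𝒟 M a mo τ₀ Ψ R U₀ Ψ₀ H A₀ S μ₀ hsync hmono hA₀ hbd hS hτS hcut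
    (fun τ hτ ↦ (eventually_ge_atTop τ).mono fun τ' hτ' ↦
      hanti hτ (show τ' ∈ Set.Ioi τ₀ from hτ.trans_le hτ') hτ')
    hμ₀

end Summit.FinalStateConjecture.FinalStateConjecture.Theorems.ClusterCompleteness.TwoPins

end
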